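import Summits.QuantumFields.BalabanUV.T4Continuum.Spine.NE2.ComposedRemainderCoherentTowerConstant
import Summits.QuantumFields.BalabanUV.T4Continuum.Spine.NE2.AdjointRepresentationKernel

/-!
# NE2 / ComposedRemainderCoherentTowerNonTrivial — WHAT IS AND IS NOT TRIVIAL AT THE gen-8 WITNESS TOWERS: the (124)-remainders VANISH, the tier-B
# transporters do NOT; the END of record is non-vacuous on data with non-trivial tier-B transporters (cell `pub-balaban-gaps`, seat ne2, generation 9; row NE2)

HONEST FRAMING.  Row NE2 (node U1a of the T⁴ uniqueness spine) is NOT PRINTED and NOT PROVED; class word WORK-bound; nothing of Bałaban's is asserted beyond print;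
ONE finite torus; NOT ℝ⁴, NOT infinite volume, NOT a mass gap, NOT Clay.  This module is [folklore] bookkeeping over the tree's model objects and changes no word.

§1 (A LOCATED CORRECTION).  At the constant-per-level towers `u_k^{(i)} ≡ exp(f(k,i)·X)` of generation 8 (`ConstantConnectionTower.cTow`) the curvature is zero, the
thin loops of [B7] (114) are closed, the loop logarithms `Y_x` and their block means `Ȳ` vanish (`ConstantConnectionTower.YxT_cTow`, `YbarT_cTow`), hence the
coefficients `G₁, G₂, G₃` of [B7] (124)'s linearisation remainder vanish (`remCoeffOf_cTow_G`) and so do the one-step and the COMPOSED remainders for ANY transporter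
readings (`QremStep_cTow`, **`Erem_cTow_eq_zero`** — the induction of `OneStepRemainderLoopFlat.Erem_remCoeffOf_one` verbatim); and the `Δ′` summand vanishes
(`deltaPrime_cTow_eq_zero`: both plaquette blocks of [B9] (3.10) are zero at zero curvature).  The row text of record (item (l),
generation 8) says «for non-central X non-trivial adjoint transport, tier-B operators, composed tables and (124)-remainders»; the last member is FALSE at these
witnesses and is corrected by this file: the (124)-remainder slot of the END's operator is ZERO there.
§2 (WHAT IS NOT TRIVIAL).  Generation 9's `AdjointRepresentationKernel.witness_towers_nontrivial` (for NON-CENTRAL `X` with `‖X‖ < ln 2` the towers have tier-B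
transporter DATA `Ad(u_k^{(k)}) ≠ 1` at every bond and non-zero NE3 connection readings, on any frame containing su(N)) + `exists_noncentral_small` (such `X`
exist below every threshold once there are two colour indices), joined with generation 8's `ComposedRemainderCoherentTowerConstant.exists_nonflat_coherent_witness`:
**`exists_nonflat_coherent_witness_nontrivial`** — on a frame with `herm0 n ≤ P` and `≥ 2` colour indices there is `t₀ > 0` such that (i) SOME skew-hermitian
non-central `X` has `‖X‖e^{‖X‖} < t₀`, and (ii) for EVERY skew-hermitian non-central `X` with `‖X‖e^{‖X‖} < t₀` and `f ∈ {cph L, sph L}` the tower `cTow f X` is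
coherent (each level Bałaban's average (42) of the next), has `Ad(u_k^{(k)}) ≠ 1` and `L^k(Ad(u_k^{(k)}) − 1) ≠ 0` at every level, direction and bond, AND satisfies the
END's `TowerLimitRate` conclusion (rate `ρ ∈ [3∕(2L), 1)`).  In words: the END of record is non-vacuous on data whose tier-B transporter DATA are not the flat data.
OPERATOR LEVEL: the companion `ConstantTransporterLaplacian` (generation 9) shows that the covariant-Laplacian summand `covPertC(Ad u)` of the tier-B perturbation IS a
non-zero operator at these towers iff `X` is non-central; whether the FULL operator of the END (with the composed-averaging summand) differs from the flat one is
NOT claimed; nothing about Bałaban's minimiser.  Every declaration is [folklore]; 0 sorry; axioms ⊆ {propext, Classical.choice, Quot.sound}.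
-/

noncomputable section

open scoped BigOperators ComplexConjugate Matrix Matrix.Norms.L2Operator Kronecker

namespace Summit.QuantumFields.BalabanUV.T4Continuum.NE2.ComposedRemainderCoherentTowerNonTrivial

open Literature.MathematicalPhysics.QuantumFieldTheory.Balaban1983to89
open Literature.MathematicalPhysics.QuantumFieldTheory.Balaban1983to89.B9AdOrthogonal (herm0)
open Literature.MathematicalPhysics.QuantumFieldTheory.Balaban1983to89.B5Prop11Plancherel (Tor fine)
open Literature.MathematicalPhysics.QuantumFieldTheory.Balaban1983to89.B5G183RateUnitTower (lev)
open Summit.QuantumFields.BalabanUV.Beta.AdjointCarrierWiringEnd (CompFamily)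
open Summit.QuantumFields.BalabanUV.T4Continuum
open Summit.QuantumFields.BalabanUV.T4Continuum.BalabanAveragedTowerUnit (idx Qlev)
open Summit.QuantumFields.BalabanUV.T4Continuum.KingPairingPlantedLaw (calDalev)
open Summit.QuantumFields.BalabanUV.T4Continuum.CovariantAveragingTower (TowerLimitRate)
open Summit.QuantumFields.BalabanUV.T4Continuum.RegularBackgroundTower (connTower)
open Summit.QuantumFields.BalabanUV.T4Continuum.NE2BalabanLayer (tierBPert)
open Summit.QuantumFields.BalabanUV.T4Continuum.NE2.CovariantTableBalaban (TBal)
open Summit.QuantumFields.BalabanUV.T4Continuum.NE2.ComposedAveragingRemainder (avgPertFull)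
open Summit.QuantumFields.BalabanUV.T4Continuum.NE2.ComposedRemainderTower (Erem Erem_zero Erem_succ QremStep)
open Summit.QuantumFields.BalabanUV.T4Continuum.NE2.OneStepRemainder (Qrem_zero_coeff)
open Summit.QuantumFields.BalabanUV.T4Continuum.NE2.OneStepRemainderLoopCoeff (YxT YbarT YbarT_eq remCoeffOf sum_blockWeight)
open Summit.QuantumFields.BalabanUV.T4Continuum.NE2.OneStepRemainderAdjoint (coeffG₁ coeffG₂ coeffG₃)
open Summit.QuantumFields.BalabanUV.T4Continuum.NE2.OneStepRemainderLoopFlat (coeffG₁_zero coeffG₂_zero coeffG₃_zero)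
open Summit.QuantumFields.BalabanUV.T4Continuum.NE2.ComposedRemainderGaugeTower (fundT adT)
open Summit.QuantumFields.BalabanUV.T4Continuum.NE2.ComposedRemainderGaugeTowerRegular (topAdT)
open Summit.QuantumFields.BalabanUV.T4Continuum.NE2.TorusBlockAveragePlaquette (bavgTor)
open Summit.QuantumFields.BalabanUV.T4Continuum.NE2.ComposedRemainderCoherentTower (liftU)
open Summit.QuantumFields.BalabanUV.T4Continuum.NE2.DeltaPrimeOperator (deltaPrime plaqBlock₁ plaqBlock₂ symF_zero brkF_zero)
open Summit.QuantumFields.BalabanUV.T4Continuum.NE2.ComposedRemainderCoherentTowerDeltaPrime (topU)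
open Summit.QuantumFields.BalabanUV.T4Continuum.NE2.ConstantConnectionTower (cTow cTow_val cTow_mem cph sph YxT_cTow reHol_const imHol_const exp_smul_mem_unitaryGroup)
open Summit.QuantumFields.BalabanUV.T4Continuum.NE2.ComposedRemainderCoherentTowerConstant (exists_nonflat_coherent_witness)
open Summit.QuantumFields.BalabanUV.T4Continuum.NE2.AdjointRepresentationKernel (witness_towers_nontrivial exists_noncentral_small)

/-- `‖X‖ ≤ ‖X‖e^{‖X‖}`; so the open set `‖X‖e^{‖X‖} < t₀ ≤ ½` lies inside the log chart `‖X‖ < ln 2`. [folklore] -/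
theorem norm_lt_log_two_of_mul_exp_lt {n : Type} [Fintype n] [DecidableEq n] {X : Matrix n n ℂ} {t₀ : ℝ} (ht : ‖X‖ * Real.exp ‖X‖ < t₀) (ht₀ : t₀ ≤ 1 / 2) :
    ‖X‖ < Real.log 2 := by
  have h1 : ‖X‖ ≤ ‖X‖ * Real.exp ‖X‖ := le_mul_of_one_le_right (norm_nonneg X) (Real.one_le_exp (norm_nonneg X))
  have hlog : (1 : ℝ) / 2 < Real.log 2 := by
    rw [Real.lt_log_iff_exp_lt (by norm_num)]
    have hsq : Real.exp (1 / 2 : ℝ) * Real.exp (1 / 2 : ℝ) = Real.exp 1 := by rw [← Real.exp_add]; norm_num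
    nlinarith [Real.exp_one_lt_d9, Real.exp_pos (1 / 2 : ℝ)]
  linarith


/-! ## §1 What IS trivial at the witness towers: the (124)-remainders vanish (flat curvature ⟹ closed thin loops ⟹ zero loop logarithms ⟹ zero coefficients) -/

section Remainders

variable {d : ℕ} (L : ℕ) [NeZero L] (M : Fin d → ℕ) [hM : ∀ μ, NeZero (M μ)]
  {n : Type} [Fintype n] [DecidableEq n] {ι : Type} [Fintype ι] [DecidableEq ι] (c : ℝ) (e : ι → Matrix n n ℂ)

/-- the block means `Ȳ` of the loop logarithms vanish at a constant-per-level tower. [cite: Balaban1985Averaging, p.35 (shape)] [folklore] -/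
theorem YbarT_cTow (f : ℕ → ℕ → ℝ) {X : Matrix n n ℂ} (hX : star X = -X) (k i : ℕ) (x : Tor (fine (lev L i) M)) (μ : Fin d) :
    YbarT L M (fundT L M (liftU L M (cTow L M f X) (cTow_mem L M f hX) k)) i x μ = 0 := by
  rw [YbarT_eq]
  exact Finset.sum_eq_zero fun r _ => by rw [YxT_cTow L M f hX k i x μ r, smul_zero]

/-- **THE (124)-REMAINDER COEFFICIENTS `G₁, G₂, G₃` VANISH** at a constant-per-level tower (they are functions of `Y_x = 0` and `Ȳ = 0` only), for ANY coarse-bond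
readings `W′`. [cite: Balaban1985Averaging, (124) p.36 (shape)] [folklore] -/
theorem remCoeffOf_cTow_G (f : ℕ → ℕ → ℝ) {X : Matrix n n ℂ} (hX : star X = -X) (W' : (i : ℕ) → Fin d → (idx L M i → Matrix ι ι ℂ)) (k i : ℕ) :
    (remCoeffOf L M (fundT L M (liftU L M (cTow L M f X) (cTow_mem L M f hX) k)) c e W').G₁ i = (fun _ _ _ => 0) ∧
      (remCoeffOf L M (fundT L M (liftU L M (cTow L M f X) (cTow_mem L M f hX) k)) c e W').G₂ i = (fun _ _ _ => 0) ∧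
      (remCoeffOf L M (fundT L M (liftU L M (cTow L M f X) (cTow_mem L M f hX) k)) c e W').G₃ i = (fun _ _ => 0) := by
  refine ⟨funext fun x => funext fun μ => funext fun r => ?_, funext fun x => funext fun μ => funext fun r => ?_,
    funext fun x => funext fun μ => ?_⟩
  · show coeffG₁ c e (YbarT L M _ i x μ) (YxT L M _ i x μ r) = 0
    rw [YbarT_cTow L M f hX, YxT_cTow L M f hX, coeffG₁_zero]
  · show coeffG₂ c e (YbarT L M _ i x μ) (YxT L M _ i x μ r) = 0
    rw [YbarT_cTow L M f hX, YxT_cTow L M f hX, coeffG₂_zero]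
  · show coeffG₃ Finset.univ (fun _ : Fin d → Fin L => ((L : ℝ) ^ d)⁻¹) c e (YbarT L M _ i x μ) (fun r => YxT L M _ i x μ r) = 0
    have h : (fun r => YxT L M (fundT L M (liftU L M (cTow L M f X) (cTow_mem L M f hX) k)) i x μ r) = fun _ => 0 :=
      funext fun r => YxT_cTow L M f hX k i x μ r
    rw [YbarT_cTow L M f hX, h, coeffG₃_zero c e _ (sum_blockWeight L)]

/-- every one-step remainder `Q″` vanishes at a constant-per-level tower, for ANY fine transporters `W` and coarse-bond readings `W′`. [folklore] -/
theorem QremStep_cTow (f : ℕ → ℕ → ℝ) {X : Matrix n n ℂ} (hX : star X = -X) (W W' : (i : ℕ) → Fin d → (idx L M i → Matrix ι ι ℂ)) (k j : ℕ) :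
    QremStep L M W (remCoeffOf L M (fundT L M (liftU L M (cTow L M f X) (cTow_mem L M f hX) k)) c e W') j = 0 := by
  haveI := B5G183RateUnitTower.lev_neZero L j
  obtain ⟨h1, h2, h3⟩ := remCoeffOf_cTow_G L M c e f hX W' k j
  rw [QremStep, h1, h2, h3]
  exact Qrem_zero_coeff (lev L j) L M (W (j + 1)) _

/-- **THE COMPOSED (124)-REMAINDERS `Erem` VANISH AT EVERY LEVEL OF A CONSTANT-PER-LEVEL TOWER**, for ANY transporter readings `W, W′` (in particular for
`Ad u`): the witness towers of generation 8 have NON-TRIVIAL tier-B transporters (§2; and a non-zero covariant-Laplacian perturbation, `ConstantTransporterLaplacian`)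
but TRIVIAL linearisation remainders (zero curvature ⟹ the thin loops of [B7] (114) are closed ⟹ `Y_x = Ȳ = 0` ⟹ `G₁ = G₂ = G₃ = 0`) — a located CORRECTION of the
prose «non-trivial (124)-remainders» in the row text of record.
[cite: Balaban1985Averaging, (124) p.36 (shape)] [folklore] -/
theorem Erem_cTow_eq_zero (f : ℕ → ℕ → ℝ) {X : Matrix n n ℂ} (hX : star X = -X) (W W' : (i : ℕ) → Fin d → (idx L M i → Matrix ι ι ℂ)) (k j : ℕ) :
    Erem L M W (remCoeffOf L M (fundT L M (liftU L M (cTow L M f X) (cTow_mem L M f hX) k)) c e W') j = 0 := by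
  induction j with
  | zero => exact Erem_zero L M W _
  | succ j ih => rw [Erem_succ, ih, QremStep_cTow L M c e f hX, Matrix.zero_mul, Matrix.mul_zero, add_zero, smul_zero]

/-- **THE `Δ′` SUMMAND VANISHES TOO** at a constant-per-level tower (zero curvature: `Re U(∂p) − 1 = 0`, `Im U(∂p) = 0`, so both plaquette blocks of [B9] (3.10) vanish), for any
normalisation `cη`. [cite: Balaban1985BackgroundPropagators, (3.10) p.392 (shape)] [folklore] -/
theorem deltaPrime_cTow_eq_zero (f : ℕ → ℕ → ℝ) {X : Matrix n n ℂ} (hX : star X = -X) (cη : ℝ) (k : ℕ) :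
    deltaPrime (fine (lev L k) M) cη c e (fun ν x => ((topU L M (cTow L M f X) (cTow_mem L M f hX) k ν x : Matrix.unitaryGroup n ℂ) : Matrix n n ℂ)) = 0 := by
  show deltaPrime (fine (lev L k) M) cη c e (fun (_ : Fin d) (_ : Tor (fine (lev L k) M)) => NormedSpace.exp (((f k k : ℝ) : ℂ) • X)) = 0
  rw [deltaPrime]
  refine Finset.sum_eq_zero fun x _ => Finset.sum_eq_zero fun q _ => ?_
  rw [plaqBlock₁, plaqBlock₂, reHol_const (exp_smul_mem_unitaryGroup hX _), imHol_const (exp_smul_mem_unitaryGroup hX _), sub_self, smul_zero,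
    symF_zero, brkF_zero]
  simp only [Matrix.mul_zero, Matrix.zero_mul, Matrix.transpose_zero, add_zero, smul_zero, Finset.sum_const_zero]

end Remainders

/-! ## §2 What is NOT trivial: the tier-B transporters; the joined END -/

section End

variable {d : ℕ} (L : ℕ) [NeZero L] (M : Fin d → ℕ) [hM : ∀ μ, NeZero (M μ)]
  {n : Type} [Fintype n] [DecidableEq n] {ι : Type} [Fintype ι] [DecidableEq ι] {c : ℝ} {P : Submodule ℝ (Matrix n n ℂ)} {e : ι → Matrix n n ℂ}
  (hF : CompFamily c P e) (a : ℝ) (ha : 0 < a) [Nonempty n] [Nonempty ι]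

/-- **THE END OF RECORD IS NON-VACUOUS ON DATA WITH NON-TRIVIAL TIER-B TRANSPORTERS.**  On a component frame containing su(N) (`herm0 n ≤ P`) with at least two colour
indices: there is `t₀ > 0` such that (i) a skew-hermitian NON-CENTRAL `X` with `‖X‖e^{‖X‖} < t₀` EXISTS, and (ii) for every skew-hermitian non-central `X` with
`‖X‖e^{‖X‖} < t₀` and `f = cph L` (constant-connection tower `exp(L^{−(k+i)}X)`) or `f = sph L` (stationary tower `exp(L^{−i}X)`): the tower `cTow f X` is COHERENT below
its top (level `i` = Bałaban's average (42) of level `i+1`), its tier-B transporter `Ad(u_k^{(k)})` is `≠ 1` and node NE3's connection reading `L^k(Ad(u_k^{(k)}) − 1)` is `≠ 0`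
at EVERY level, direction and bond, and the resolvent tower of [free block Laplacian] + [tier B at `Ad u_top`] + [print's composed averaging `TBal(Ad u)` with (124)'s
remainders `Erem`] + [`Δ′(u_top)`] built on it satisfies `TowerLimitRate` at rate `ρ` — generation 8's `exists_nonflat_coherent_witness` and generation 9's
`witness_towers_nontrivial` ∕ `exists_noncentral_small` joined.  TOY data, not Bałaban's minimiser; NE2 NOT proved.
[cite: Balaban1985BackgroundPropagators, (3.3) p.390, (3.26) p.395; Balaban1985Averaging, (42) p.23 (shapes)] [folklore] -/
theorem exists_nonflat_coherent_witness_nontrivial [Nontrivial n] (hP : herm0 n ≤ P) (hL : 2 ≤ L) (hd : 1 ≤ d) {ρ : ℝ} (hρ : 3 / (2 * (L : ℝ)) ≤ ρ) (hρ1 : ρ < 1) :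
    ∃ t₀ : ℝ, 0 < t₀ ∧
      (∃ X : Matrix n n ℂ, star X = -X ∧ X ∉ Set.range (Matrix.scalar n) ∧ ‖X‖ * Real.exp ‖X‖ < t₀) ∧
      ∀ (X : Matrix n n ℂ) (hX : star X = -X), ‖X‖ * Real.exp ‖X‖ < t₀ → X ∉ Set.range (Matrix.scalar n) → ∀ f : ℕ → ℕ → ℝ, (f = cph L ∨ f = sph L) →
        (∀ k i, i < k → cTow L M f X k i = bavgTor (lev L i) L M (cTow L M f X k (i + 1))) ∧
        (∀ (k : ℕ) (ν : Fin d) (b : idx L M k), topAdT L M hF (liftU L M (cTow L M f X) (cTow_mem L M f hX)) k ν b ≠ 1 ∧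
            connTower L M (topAdT L M hF (liftU L M (cTow L M f X) (cTow_mem L M f hX))) k ν b ≠ 0) ∧
        ∃ Cp : ℝ, TowerLimitRate (fun k => Qlev L M k ⊗ₖ (1 : Matrix ι ι ℂ)) ((L : ℝ) ^ d)
          (fun k => (calDalev L M a ha k ⊗ₖ (1 : Matrix ι ι ℂ)
            + tierBPert L M (topAdT L M hF (liftU L M (cTow L M f X) (cTow_mem L M f hX)))
                (avgPertFull L M a (fun k => TBal L M (adT L M hF (liftU L M (cTow L M f X) (cTow_mem L M f hX) k)) k)
                  (fun k => Erem L M (adT L M hF (liftU L M (cTow L M f X) (cTow_mem L M f hX) k))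
                    (remCoeffOf L M (fundT L M (liftU L M (cTow L M f X) (cTow_mem L M f hX) k)) c e (adT L M hF (liftU L M (cTow L M f X) (cTow_mem L M f hX) k))) k))
                (fun k => deltaPrime (fine (lev L k) M) (lev L k) c e (fun ν x => (topU L M (cTow L M f X) (cTow_mem L M f hX) k ν x : Matrix n n ℂ))) k)⁻¹) Cp ρ := by
  obtain ⟨t₁, ht₁, hW⟩ := exists_nonflat_coherent_witness L M hF a ha hL hd hρ hρ1
  refine ⟨min t₁ (1 / 2), lt_min ht₁ (by norm_num), ?_, fun X hX hXt hXc f hf => ?_⟩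
  · obtain ⟨X, hX, hXc, -, hXt⟩ := exists_noncentral_small (n := n) (lt_min ht₁ (by norm_num : (0 : ℝ) < 1 / 2))
    exact ⟨X, hX, hXc, hXt⟩
  have hXs : ‖X‖ < Real.log 2 := norm_lt_log_two_of_mul_exp_lt (lt_of_lt_of_le hXt (min_le_right _ _)) le_rfl
  obtain ⟨u, hu, Cp, hcoh, hval, hT⟩ := hW X hX (lt_of_lt_of_le hXt (min_le_left _ _)) f hf
  have hu' : u = cTow L M f X := by
    funext k i y κ
    exact Units.ext (by rw [hval, cTow_val])
  subst hu'
  exact ⟨hcoh, fun k ν b => witness_towers_nontrivial hF L M hP hX hXs hXc hf k ν b, Cp, hT⟩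

end End

end Summit.QuantumFields.BalabanUV.T4Continuum.NE2.ComposedRemainderCoherentTowerNonTrivial

end
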